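import Summits.BirchSwinnertonDyer.BirchSwinnertonDyer.Theses.PrintCf2
import Summits.BirchSwinnertonDyer.Rank1Residual.WAll.AltClosersCMTwoRamifiedGenusClass
import HarnessLib

/-!
# Route `PrintCf2`, aside stmt-BirchSwinnertonDyer-20470 `RamifiedAtlasFJOfFactsOdd` — CLOSED (cell `bsd-print-cf2`, p1)

HONEST FRAMING (cell `bsd-print-cf2`, run/shared/lean/pub/bsd-print-cf2/; route `PrintCf2`, leaf CornerF @ `p = 2` =
`WAllCornerFTwo`, OPEN AS A CLASS): a CLOSING file — it imports the route file and proves ONE item whose statement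
carries its published inputs as an antecedent (facts-relative «OfFacts» typing; nothing asserted, no named fact
introduced). The mathematics is in the seat's W-ALL files `Rank1Residual/WAll/TargetCMTwoRamifiedFamilies.lean`
(p533515), `…/AltClosersCMTwoRamifiedFamilies.lean` (p535702), `…/TargetCMTwoRamifiedOffTYZProved.lean` (p536500),
`…/AltClosersCMTwoRamifiedGenusClass.lean` (p538378); here only the one-line term. Strategy sentence (p1): «Tian–Yuan–Zhang
induction BY NAME … 2-part of BSD for E_n with controlled prime factorisations, typed as class theorems on explicit
infinite families».

THE ITEM: granted 𝔅_ram ∧ Monsky's odd-case `2`-Selmer count (Heath-Brown 1994 appendix), the leaf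
`WAllCornerFTwoRamifiedTYZAtlasFJ` — BSD(E,2) for every globally minimal CM rank-one curve with `2` ramified that is a
model of a member of the «bsd-p2» `ω = 3` Faulkner–James atlas (`CongruentTYZAtlasFJFamily`). In fact the Monsky-odd
conjunct is NOT needed: it is a tree theorem (`HeathBrown1994.monsky_card_selmerGroup_two_odd_holds`), as is
Rédei–Reichardt; the closer `Rank1Residual.WAll.PrintCf2.wAllCornerFTwoRamifiedTYZAtlasFJ_of_facts` (p538378) uses only
TYZ17 Thm 1.2′ and GZK from 𝔅_ram (so the registered stub `stub_offTYZ_atlasFJLeaf` of crux 20509 closes too —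
sibling file). Beyond print: YES (flag-free assembly). [cite: TianYuanZhang2017, Thm. 1.2 (as printed)]
[cite: FaulknerJames2007, Thm. 1.2 (2)] [cite: HeathBrown1994SelmerCongruentII, Appendix (Monsky)] [cite: Miller2011LMS, Def. 1.1]
-/

noncomputable section

open scoped Classical

open Summit.BirchSwinnertonDyer Summit.BirchSwinnertonDyer.Rank1Residual.WAll
open Summit.BirchSwinnertonDyer.BirchSwinnertonDyer.Theses.PrintCf2

set_option autoImplicit false
-- `Summit.BirchSwinnertonDyer.BirchSwinnertonDyer.Theorems` is the layout's namespace (Sub = Summit name).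
set_option linter.dupNamespace false

namespace Summit.BirchSwinnertonDyer.BirchSwinnertonDyer.Theorems

/-- **Aside 20470 `RamifiedAtlasFJOfFactsOdd` holds** (facts used: TYZ Thm 1.2′ = conjunct 5 and GZK = conjunct 1 of
𝔅_ram; the Monsky-odd conjunct is discharged in the tree and ignored). [cite: TianYuanZhang2017, Thm. 1.2 (as printed)]
[cite: FaulknerJames2007, Thm. 1.2 (2)] -/
theorem ramifiedAtlasFJOfFactsOdd_proof : RamifiedAtlasFJOfFactsOdd :=
  fun h ↦ Rank1Residual.WAll.PrintCf2.wAllCornerFTwoRamifiedTYZAtlasFJ_of_facts h.1.2.2.2.2.1 h.1.1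

end Summit.BirchSwinnertonDyer.BirchSwinnertonDyer.Theorems

end
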